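import Literature.MathematicalPhysics.QuantumFieldTheory.Balaban1983to89.B9Thm34GpKernelFinal

/-!
# `Balaban1983to89.B9Ineq346L2Final` — [Balaban1985BackgroundPropagators] THEOREM 3.4 p. 400 × THEOREM 3.1 (3.46) p. 398 / THEOREM 3.3 p. 399: THE `L²`
# MEMBERS (3.46)₁,₂,₃,₅ («‖hG′λ‖, ‖h∇_UG′λ‖, ‖hG′∇*_Uλ‖, ‖h∇_UG′∇*_Uλ‖ ≦ B₀[(Lʲη)², Lʲη, Lʲη, 1]|h|e^{−δ₀d(y,y′)}‖λ‖») FOR BOTH EXTENDED OPERATORS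
# `G′(U′U)` (3.64) AND `G(U′U)` (FILE 28), AT THE FINAL LEVEL — from the KERNEL form of (3.42) for the extended operators (FILES 16/28) by SCHUR's test
# and [4] Lemma 2.1 for the block-volume weight; FILE 39 of the Sect. B programme of cell `lit-balaban`, seat r06 gen 18; narrows GAPS G-B9-02 to the
# two second-difference `L²` members (3.46)₄,₆

statement-level skeleton of published theorems with citation tags; proofs where landed; nothing here is a claim about the Yang–Mills mass gap

CITATION HEADER (lean-in-tree rule).  B9 = T. Bałaban, *Propagators for lattice gauge theories in a background field*, Commun. Math. Phys. **99** (1985)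
389–434 [Balaban1985BackgroundPropagators] (doi 10.1007/bf01240355; `paper:balaban1985-cmp99-background-propagators`, journal page = PDF page + 388):
Theorem 3.1 p. 397–398 [PDF 9–10], (3.46) verbatim (page image `inprint/lit-balaban-p05/renders/cmp99b/p10.png`, re-read by this seat): «Finally, we have the inequalities in L²-norms ‖hG′(U)λ‖, ‖h∇_UG′(U)λ‖, ‖hG′(U)∇*_Uλ‖, ‖h∇_U∇_UG′(U)λ‖, ‖h∇_UG′(U)∇*_Uλ‖, ‖hG′(U)∇*_U∇*_Uλ‖ ≦ B₀[(Lʲη)², Lʲη, Lʲη, 1, 1, 1]|h|e^{−δ₀d(y,y′)}‖λ‖ for supp h ⊂ Δ(y), y ∈ Λ_j, supp λ ⊂ Δ(y′); (3.46)»;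
the remark after (3.47): «At first the choice of derivatives ∇_U, ∇*_U is conventional, we may always replace ∇_U by ∇*_U, and vice versa, in arbitrary
place and combination. Next, the choice of powers Lʲη is conventional also. Using Lemma 2.1 in [4] we may replace the factor (Lʲη)^α by
(Lʲη)^β(L^{j′}η)^γ with β + γ = α, j, j′ are indices of localizations.»; Theorem 3.3 p. 399 [PDF 11] («the operator G(U) (a = 1) satisfies the
inequalities (3.42)–(3.47), with G′(U) replaced by G(U) and λ replaced by a function J defined at bonds of the lattice»); Theorem 3.4 p. 400 [PDF 12]
(«The extended operators satisfy all the inequalities of Theorems 3.1–3.3 correspondingly»); p. 403 l. 2–5 and p. 407 («This way we get all these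
inequalities for the operator G(U′U), the local ones follow from the bound (3.85) and Lemma 2.1 [4]»); the kernel pairing p. 393 (`c = η^d`, block
volume `(L^{j′}η)^d`; «if y ∈ Λ_j, then Δ(y) = Bʲ(y), and Δ̃(y) is a cube of the size 2Lʲη on the lattice T_η with center at the point y», p. 397).  [4] = T. Bałaban, *Propagators and renormalization transformations for lattice gauge
theories. II*, Commun. Math. Phys. **96** (1984) 223–250 [Balaban1984PropagatorsII], (2.64)–(2.66) p. 234 (kernel shape), Lemma 2.1 p. 234.  Cell
`lit-balaban`, seat r06 (B9 fold owner) gen 18, FILE 39; SKELETON rows **B9.Thm3.4** × B9.Thm3.1 ((3.46) cell) × B9.Thm3.3 (cells); no row head changes.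

WHY THIS FILE (B9-CLOSURE §5 item 3 (O)).  After FILES 36–38 the sup (3.42), sup-Hölder (3.43), input-Hölder (3.44)/(3.45) and global (3.47) members of
Theorems 3.1/3.3 are theorems at the final level for both extended operators; the `L²` members (3.46) remained («needs ℓ²-block/Schur majorants — none in
tree», B9-CLOSURE v2.1–v2.3).  For the four members with AT MOST ONE difference on each side no ℓ²-block calculus is needed: they follow from the KERNEL
form of (3.42) — which FILES 16 (`thm34_Gp_kernel_final`, `G′(U′U)`) and 28 (`thm34_all_final`, `G(U′U)`) already deliver for the extended operators — by
SCHUR's test on a pair of blocks (Cauchy–Schwarz: `|(Tλ)(x)| ≦ cK(y,y′)v(y′)⁻¹(#Δ(y′))^{1/2}‖λ‖₂`, then the sum over `x ∈ Δ(y)`), which produces the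
(3.46) shape with the block-volume ratio `(v(y)/v(y′))^{1/2} = (Lʲη)^{d/2}(L^{j′}η)^{−d/2}`, and the p. 398 remark ([4] Lemma 2.1 for the weight `v^{−1/2}`)
converts the ratio into a loss of rate — exactly the «conventional» equivalence of weightings the print allows itself.
* §1 (abstract block carrier, [4] vocabulary): `abs_apply_le_of_kernelBound`, **`l2_block_of_kernelBound`** (ratio form, no geometry hypothesis),
  **`l2_block_of_kernelBound_transfer`** (printed form under the scale transfer of `v^{−1/2}`).
* §2 **`thm34_Gp_l2_final`** — HYPOTHESES = FILE 16 `B9Thm34GpKernelFinal.thm34_Gp_kernel_final` VERBATIM (the `G′`-only data incl. Theorem 3.1's (3.42)₁₋₄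
  for `G′(U)` in kernel form) + NEW: the block volumes in the pairing `c·#Δ(y) ≦ c_v·v(y)` (`hvol`, the shape of `B6RandomWalkKernel.hasMajorant_of_hasKernelBound`)
  and [4] Lemma 2.1 for the weight `v^{−1/2}` (`hSTv`, the shape of `hST`); CONCLUSION `∃ a₁ > 0 ∃ B ≧ 0 ∀ α₁ ≦ a₁ ∀ A kF sF …` (FILE 16's premises
  verbatim): the inverse identities of `G′(U′U)` (re-exported) ∧ for all `y, y′`, all `h` with `|h| ≦ H`, `supp h ⊂ Δ(y)` and all `λ` with `supp λ ⊂
  Δ(y′)`: `‖hG′(U′U)λ‖₂ ≦ BH(Lʲη)²e^{−(3δ₀/4)d(y,y′)}‖λ‖₂`, `‖h∇_kG′(U′U)λ‖₂, ‖hG′(U′U)∇_lλ‖₂ ≦ BH(Lʲη)e^{−(3δ₀/4)d}‖λ‖₂`, `‖h∇_kG′(U′U)∇_lλ‖₂ ≦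
  BHe^{−(3δ₀/4)d}‖λ‖₂` (`k, l ∈ κ ⊕ κ`, the `2d` concrete first differences).
* §3 **`thm34_G_l2_final`** — HYPOTHESES = FILE 28 `B9Thm34AllFinal.thm34_all_final` VERBATIM + `hvol` (bond carrier) + `hSTv`; CONCLUSION `∃ a₁ ∃ B ∀ α₁ …`
  (FILE 28's premises verbatim) `∃ C⁻¹(U′U), G(U′U)` with FILE 28's defining identities (ii)/(iii) (so `left_inv_eq_right_inv` identifies the pair with
  the one of FILES 28/36/37) ∧ the same four `L²` members for `G(U′U)` at the rate `δ₀/20`.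

HONEST SCOPE.  (a) Covered: the four members of (3.46) with at most one difference on each side, for both extended operators; NOT covered: the two
members with two differences on one side, `‖h∇_U∇_UG′λ‖` and `‖hG′∇*_U∇*_Uλ‖` ((3.46)₄,₆) — they are not consequences of (3.42) and need the `L²`
regularity of [4] for `U` plus a second-difference letter calculus (B9-CLOSURE (O′), open).  (b) The route is kernel ⇒ `L²` (Schur), using only the
printed kernel inequalities for the extended operators; the print's own sentence is a convergence-of-the-series argument in each norm (p. 407) — same
inputs, different bookkeeping.  (c) Norms: counting `ℓ²` norms of the REAL COORDINATES of FILES 1–38 (carrier `S × ι`, resp. `(κ × S) × ι`) on both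
sides — the pairing weight `c = η^d` cancels; the equivalence with the `𝔤`-valued `L²(η^d)` norms is the fixed basis comparison (`hrepr`, `Σ‖b_i‖`),
not restated; `|h|` is the sup of the coordinate multiplier `h` (print: a scalar function with `supp h ⊂ Δ(y)`; here any coordinate function supported
in the block — more general).  (d) NEW HYPOTHESES beyond FILES 16/28: `hvol` (print: `v(y) = (Lʲη)^d`, `c = η^d`, `Δ(y) = Bʲ(y)`, so `c_v` = the number of real
coordinates per lattice point of the carrier) and `hSTv` = [4] Lemma 2.1 for `v^{−1/2}` in the shape of `hST` (p. 398 remark); without `hSTv`, §1 `l2_block_of_kernelBound` gives every member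
with the explicit ratio `(v(y)/v(y′))^{1/2}` instead of the rate loss.  (e) Right differences are the letters `∇_l` (print `∇*_U`; «conventional»).  (f) No
new definition, no named fact, no row head change (B9.Thm3.4 stays `typed-existing`).

Depends on: `B9Thm34GpKernelFinal` (FILE 16), `B9Thm34AllFinal` (FILE 28), `B6RandomWalkKernel` (`ker`, `apply_eq_sum_ker`, `HasKernelBound`,
`hasKernelBound_mono`), `B9Ineq347` (`ScaleTransfer`), Mathlib `Real.sum_mul_le_sqrt_mul_sqrt` (Cauchy–Schwarz) — all used BY NAME.
-/

noncomputable section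

namespace Literature.MathematicalPhysics.QuantumFieldTheory.Balaban1983to89.B9Ineq346L2Final

open NormedSpace Complex
open Literature.MathematicalPhysics.QuantumFieldTheory.Balaban1983to89
open Literature.MathematicalPhysics.QuantumFieldTheory.Balaban1983to89.B6RandomWalk (HasMajorant BlockSupp Triangle254 Ineq261)
open Literature.MathematicalPhysics.QuantumFieldTheory.Balaban1983to89.B6RandomWalkHom (HasMajorantHom)
open Literature.MathematicalPhysics.QuantumFieldTheory.Balaban1983to89.B6RandomWalkKernel (ker apply_eq_sum_ker HasKernelBound hasKernelBound_mono)
open Literature.MathematicalPhysics.QuantumFieldTheory.Balaban1983to89.B6RandomWalkSection (secExt secRes secConj)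
open Literature.MathematicalPhysics.QuantumFieldTheory.Balaban1983to89.B9Thm34Ext (toB6)
open Literature.MathematicalPhysics.QuantumFieldTheory.Balaban1983to89.B9Ineq347 (ScaleTransfer)
open Literature.MathematicalPhysics.QuantumFieldTheory.Balaban1983to89.B9Eq386Neumann (pTwo deltaA)
open Literature.MathematicalPhysics.QuantumFieldTheory.Balaban1983to89.B9Eq39Adjoint
open Literature.MathematicalPhysics.QuantumFieldTheory.Balaban1983to89.B9Eq369Small (Through)
open Literature.MathematicalPhysics.QuantumFieldTheory.Balaban1983to89.B9Eq372Locality (stBonds)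
open Literature.MathematicalPhysics.QuantumFieldTheory.Balaban1983to89.B9Eq352DivForm (tauF tauB)
open Literature.MathematicalPhysics.QuantumFieldTheory.Balaban1983to89.B9Eq352DivFormLetters
open Literature.MathematicalPhysics.QuantumFieldTheory.Balaban1983to89.B9Eq352GradLetters (diffLetter)
open Literature.MathematicalPhysics.QuantumFieldTheory.Balaban1983to89.B9Eq371GradLetters (bT bU)
open Literature.MathematicalPhysics.QuantumFieldTheory.Balaban1983to89.B9Eq372RemLetters (lapDDLetter)
open Literature.MathematicalPhysics.QuantumFieldTheory.Balaban1983to89.B9Eq382V3Letters (dPrimeLetter)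
open Literature.MathematicalPhysics.QuantumFieldTheory.Balaban1983to89.B9Eq376POneLetters (conjHom gradLin divLin)
open Literature.MathematicalPhysics.QuantumFieldTheory.Balaban1983to89.B9Eq360Vprime (gPrimeExtEnd)
open Literature.MathematicalPhysics.QuantumFieldTheory.Balaban1983to89.B9Eq360VprimeLetters (vPrimeConc)
open Literature.MathematicalPhysics.QuantumFieldTheory.Balaban1983to89.B9Thm34GpKernelFinal (thm34_Gp_kernel_final)
open Literature.MathematicalPhysics.QuantumFieldTheory.Balaban1983to89.B9Thm34AllFinal (thm34_all_final)

/-! ## §1  Schur's test on a pair of blocks: kernel bound ⇒ `L²` block bound ([4] (2.64)–(2.66) shape, counting `ℓ²` norms) -/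

section Schur

variable {g : B9.Geometry} [Fintype g.Site] [DecidableEq g.Site] {R : ℝ} {H : Prop} {X : Type} [Fintype X] [DecidableEq X]

/-- **Schur step, pointwise** (bookkeeping for (3.46)): a KERNEL bound `|T(x,x′)| ≦ K(y,y′)v(y′)⁻¹` ([4] (2.64)–(2.66) shape, `HasKernelBound`) and
Cauchy–Schwarz over the block of `y′` give `|(Tλ)(x)| ≦ c·K(y,y′)v(y′)⁻¹·(#Δ(y′))^{1/2}‖λ‖₂` for `supp λ ⊂ Δ(y′)` (counting ℓ² norm of the real coordinates).
[cite: Balaban1985BackgroundPropagators, (3.42)/(3.46) pp.397–398; Balaban1984PropagatorsII, (2.64)–(2.66) p.234 (bookkeeping ours)] -/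
theorem abs_apply_le_of_kernelBound (blk : X → g.Site) {v : g.Site → ℝ} (hv : ∀ y, 0 < v y) {c : ℝ} (hc : 0 < c)
    {T : Module.End ℝ (X → ℝ)} {K : g.Site → g.Site → ℝ} (hK : ∀ a a', 0 ≤ K a a')
    (h : HasKernelBound (g := toB6 g R H) blk v c T K) (y' : g.Site) (μ : X → ℝ) (hμ0 : ∀ x, blk x ≠ y' → μ x = 0) (x : X) :
    |T μ x| ≤ c * K (blk x) y' * (v y')⁻¹ *
      (Real.sqrt (((Finset.univ.filter (fun x' : X => blk x' = y')).card : ℝ)) * Real.sqrt (∑ x', μ x' ^ 2)) := by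
  classical
  have hpre : 0 ≤ c * K (blk x) y' * (v y')⁻¹ := mul_nonneg (mul_nonneg hc.le (hK _ _)) (inv_nonneg.mpr (hv y').le)
  rw [apply_eq_sum_ker hc.ne' T μ x]
  have hsum : ∑ x' : X, c * ker c T x x' * μ x' = ∑ x' ∈ Finset.univ.filter (fun x' : X => blk x' = y'), c * ker c T x x' * μ x' := by
    rw [← Finset.sum_filter_add_sum_filter_not Finset.univ (fun x' : X => blk x' = y')]
    have h0 : ∑ x' ∈ Finset.univ.filter (fun x' : X => ¬ blk x' = y'), c * ker c T x x' * μ x' = 0 :=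
      Finset.sum_eq_zero fun x' hx' => by
        rw [Finset.mem_filter] at hx'
        rw [hμ0 x' hx'.2, mul_zero]
    rw [h0, add_zero]
  rw [hsum]
  calc |∑ x' ∈ Finset.univ.filter (fun x' : X => blk x' = y'), c * ker c T x x' * μ x'|
      ≤ ∑ x' ∈ Finset.univ.filter (fun x' : X => blk x' = y'), |c * ker c T x x' * μ x'| := Finset.abs_sum_le_sum_abs _ _
    _ ≤ ∑ x' ∈ Finset.univ.filter (fun x' : X => blk x' = y'), (c * K (blk x) y' * (v y')⁻¹) * (|μ x'| * 1) := by
        refine Finset.sum_le_sum fun x' hx' => ?_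
        have hx'b : blk x' = y' := (Finset.mem_filter.mp hx').2
        have hk := h x x'
        rw [hx'b] at hk
        rw [abs_mul, abs_mul, abs_of_pos hc, mul_one]
        have h1 : c * |ker c T x x'| ≤ c * (K (blk x) y' * (v y')⁻¹) := mul_le_mul_of_nonneg_left hk hc.le
        calc c * |ker c T x x'| * |μ x'| ≤ c * (K (blk x) y' * (v y')⁻¹) * |μ x'| := mul_le_mul_of_nonneg_right h1 (abs_nonneg _)
          _ = c * K (blk x) y' * (v y')⁻¹ * |μ x'| := by ring
    _ = (c * K (blk x) y' * (v y')⁻¹) * ∑ x' ∈ Finset.univ.filter (fun x' : X => blk x' = y'), |μ x'| * 1 := by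
        rw [Finset.mul_sum]
    _ ≤ (c * K (blk x) y' * (v y')⁻¹) *
          (Real.sqrt (∑ x' ∈ Finset.univ.filter (fun x' : X => blk x' = y'), |μ x'| ^ 2) *
            Real.sqrt (∑ x' ∈ Finset.univ.filter (fun x' : X => blk x' = y'), (1 : ℝ) ^ 2)) :=
        mul_le_mul_of_nonneg_left (Real.sum_mul_le_sqrt_mul_sqrt _ (fun x' => |μ x'|) (fun _ => (1 : ℝ))) hpre
    _ ≤ (c * K (blk x) y' * (v y')⁻¹) *
          (Real.sqrt (∑ x', μ x' ^ 2) * Real.sqrt (((Finset.univ.filter (fun x' : X => blk x' = y')).card : ℝ))) := by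
        refine mul_le_mul_of_nonneg_left ?_ hpre
        refine mul_le_mul ?_ ?_ (Real.sqrt_nonneg _) (Real.sqrt_nonneg _)
        · refine Real.sqrt_le_sqrt ?_
          simp only [sq_abs]
          exact Finset.sum_le_sum_of_subset_of_nonneg (Finset.subset_univ _) fun x' _ _ => sq_nonneg (μ x')
        · refine Real.sqrt_le_sqrt (le_of_eq ?_)
          simp only [one_pow, Finset.sum_const, nsmul_eq_mul, mul_one]
    _ = c * K (blk x) y' * (v y')⁻¹ *
          (Real.sqrt (((Finset.univ.filter (fun x' : X => blk x' = y')).card : ℝ)) * Real.sqrt (∑ x', μ x' ^ 2)) := by ring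

/-- **SCHUR: KERNEL BOUND ⇒ L² BLOCK BOUND.**  If `|T(x,x′)| ≦ K(y,y′)v(y′)⁻¹` and the blocks have volume `c·#Δ(y) ≦ c_v·v(y)` in the pairing
(print: `c = η^d`, `v(y) = (Lʲη)^d`, p. 393), then for `supp h ⊂ Δ(y)`, `|h| ≦ H`, `supp λ ⊂ Δ(y′)`: `‖h·Tλ‖₂ ≦ c_v·H·K(y,y′)·(v(y)/v(y′))^{1/2}·‖λ‖₂`
(counting ℓ² norms of the real coordinates; the pairing weight `c` cancels between the two sides) — the (3.46)-shape «‖hTλ‖ ≦ (…)|h|e^{−δ₀d(y,y′)}‖λ‖» with the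
block-volume ratio explicit, one of the print's «conventional» equivalent weightings (p. 398: «Using Lemma 2.1 in [4] we may replace the factor (Lʲη)^α by
(Lʲη)^β(L^{j′}η)^γ with β + γ = α»). [cite: Balaban1985BackgroundPropagators, (3.46) p.398 + p.393; Balaban1984PropagatorsII, (2.64)–(2.66) p.234 (bookkeeping ours)] -/
theorem l2_block_of_kernelBound (blk : X → g.Site) {v : g.Site → ℝ} (hv : ∀ y, 0 < v y) {c cv : ℝ} (hc : 0 < c)
    (hvol : ∀ y : g.Site, c * ((Finset.univ.filter (fun x : X => blk x = y)).card : ℝ) ≤ cv * v y)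
    {T : Module.End ℝ (X → ℝ)} {K : g.Site → g.Site → ℝ} (hK : ∀ a a', 0 ≤ K a a')
    (h : HasKernelBound (g := toB6 g R H) blk v c T K)
    (y y' : g.Site) (hf μ : X → ℝ) (Hh : ℝ) (hHh : 0 ≤ Hh) (hh : ∀ x, |hf x| ≤ Hh) (hh0 : ∀ x, blk x ≠ y → hf x = 0)
    (hμ0 : ∀ x, blk x ≠ y' → μ x = 0) :
    Real.sqrt (∑ x, (hf x * T μ x) ^ 2) ≤ cv * Hh * K y y' * Real.sqrt (v y / v y') * Real.sqrt (∑ x, μ x ^ 2) := by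
  classical
  have hN : 0 ≤ Real.sqrt (∑ x, μ x ^ 2) := Real.sqrt_nonneg _
  have hvy : 0 < v y := hv y
  have hvy' : 0 < v y' := hv y'
  have hQ0 : 0 ≤ c * K y y' * (v y')⁻¹ *
      (Real.sqrt (((Finset.univ.filter (fun x' : X => blk x' = y')).card : ℝ)) * Real.sqrt (∑ x', μ x' ^ 2)) :=
    mul_nonneg (mul_nonneg (mul_nonneg hc.le (hK _ _)) (inv_nonneg.mpr hvy'.le)) (mul_nonneg (Real.sqrt_nonneg _) hN)
  -- pointwise: the summand vanishes off the block of `y`, and is at most `(Hh·Q)²` on it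
  have hpt : ∀ x, (hf x * T μ x) ^ 2 ≤
      if blk x = y then (Hh * (c * K y y' * (v y')⁻¹ *
        (Real.sqrt (((Finset.univ.filter (fun x' : X => blk x' = y')).card : ℝ)) * Real.sqrt (∑ x', μ x' ^ 2)))) ^ 2 else 0 := by
    intro x
    by_cases hx : blk x = y
    · rw [if_pos hx]
      have h2 := abs_apply_le_of_kernelBound (R := R) (H := H) blk hv hc hK h y' μ hμ0 x
      rw [hx] at h2
      have h1 : |hf x * T μ x| ≤ Hh * (c * K y y' * (v y')⁻¹ *
          (Real.sqrt (((Finset.univ.filter (fun x' : X => blk x' = y')).card : ℝ)) * Real.sqrt (∑ x', μ x' ^ 2))) := by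
        rw [abs_mul]
        exact mul_le_mul (hh x) h2 (abs_nonneg _) hHh
      calc (hf x * T μ x) ^ 2 = |hf x * T μ x| ^ 2 := (sq_abs _).symm
        _ ≤ _ := pow_le_pow_left₀ (abs_nonneg _) h1 2
    · rw [if_neg hx, hh0 x hx, zero_mul]
      simp
  have hsum : ∑ x, (hf x * T μ x) ^ 2 ≤ ((Finset.univ.filter (fun x : X => blk x = y)).card : ℝ) *
      (Hh * (c * K y y' * (v y')⁻¹ *
        (Real.sqrt (((Finset.univ.filter (fun x' : X => blk x' = y')).card : ℝ)) * Real.sqrt (∑ x', μ x' ^ 2)))) ^ 2 := by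
    refine (Finset.sum_le_sum fun x _ => hpt x).trans (le_of_eq ?_)
    rw [Finset.sum_ite, Finset.sum_const_zero, add_zero, Finset.sum_const, nsmul_eq_mul]
  have h1 : Real.sqrt (∑ x, (hf x * T μ x) ^ 2) ≤ Real.sqrt (((Finset.univ.filter (fun x : X => blk x = y)).card : ℝ)) *
      (Hh * (c * K y y' * (v y')⁻¹ *
        (Real.sqrt (((Finset.univ.filter (fun x' : X => blk x' = y')).card : ℝ)) * Real.sqrt (∑ x', μ x' ^ 2)))) := by
    refine (Real.sqrt_le_sqrt hsum).trans (le_of_eq ?_)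
    rw [Real.sqrt_mul (Nat.cast_nonneg _), Real.sqrt_sq (mul_nonneg hHh hQ0)]
  refine h1.trans ?_
  -- the block volumes in the pairing: `c·√#Δ(y)·√#Δ(y′) ≦ c_v √v(y) √v(y′)`
  have hcv : 0 ≤ cv := by
    have h4 : 0 ≤ c * ((Finset.univ.filter (fun x : X => blk x = y)).card : ℝ) := by positivity
    have h0 : 0 * v y ≤ cv * v y := by rw [zero_mul]; exact h4.trans (hvol y)
    exact le_of_mul_le_mul_right h0 hvy
  have hprod : c * (Real.sqrt (((Finset.univ.filter (fun x : X => blk x = y)).card : ℝ)) *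
        Real.sqrt (((Finset.univ.filter (fun x' : X => blk x' = y')).card : ℝ))) ≤ cv * (Real.sqrt (v y) * Real.sqrt (v y')) := by
    have e1 : c * (Real.sqrt (((Finset.univ.filter (fun x : X => blk x = y)).card : ℝ)) *
        Real.sqrt (((Finset.univ.filter (fun x' : X => blk x' = y')).card : ℝ))) =
        Real.sqrt (c * ((Finset.univ.filter (fun x : X => blk x = y)).card : ℝ)) * Real.sqrt (c * ((Finset.univ.filter (fun x' : X => blk x' = y')).card : ℝ)) := by
      rw [Real.sqrt_mul hc.le, Real.sqrt_mul hc.le, mul_mul_mul_comm, Real.mul_self_sqrt hc.le]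
    have e2 : cv * (Real.sqrt (v y) * Real.sqrt (v y')) = Real.sqrt (cv * v y) * Real.sqrt (cv * v y') := by
      rw [Real.sqrt_mul hcv, Real.sqrt_mul hcv, mul_mul_mul_comm, Real.mul_self_sqrt hcv]
    rw [e1, e2]
    exact mul_le_mul (Real.sqrt_le_sqrt (hvol y)) (Real.sqrt_le_sqrt (hvol y')) (Real.sqrt_nonneg _) (Real.sqrt_nonneg _)
  have eS : Real.sqrt (v y) * Real.sqrt (v y') * (v y')⁻¹ = Real.sqrt (v y / v y') := by
    have hsq : Real.sqrt (v y') ≠ 0 := (Real.sqrt_pos.mpr hvy').ne'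
    rw [Real.sqrt_div' (v y) hvy'.le, div_eq_mul_inv, mul_assoc]
    congr 1
    calc Real.sqrt (v y') * (v y')⁻¹ = Real.sqrt (v y') * (Real.sqrt (v y') * Real.sqrt (v y'))⁻¹ := by
          rw [Real.mul_self_sqrt hvy'.le]
      _ = (Real.sqrt (v y'))⁻¹ := by rw [mul_inv, ← mul_assoc, mul_inv_cancel₀ hsq, one_mul]
  have hpre2 : 0 ≤ Hh * K y y' * Real.sqrt (∑ x', μ x' ^ 2) * (v y')⁻¹ :=
    mul_nonneg (mul_nonneg (mul_nonneg hHh (hK _ _)) hN) (inv_nonneg.mpr hvy'.le)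
  calc Real.sqrt (((Finset.univ.filter (fun x : X => blk x = y)).card : ℝ)) *
        (Hh * (c * K y y' * (v y')⁻¹ *
          (Real.sqrt (((Finset.univ.filter (fun x' : X => blk x' = y')).card : ℝ)) * Real.sqrt (∑ x', μ x' ^ 2))))
      = Hh * K y y' * Real.sqrt (∑ x', μ x' ^ 2) * (v y')⁻¹ *
          (c * (Real.sqrt (((Finset.univ.filter (fun x : X => blk x = y)).card : ℝ)) *
            Real.sqrt (((Finset.univ.filter (fun x' : X => blk x' = y')).card : ℝ)))) := by ring
    _ ≤ Hh * K y y' * Real.sqrt (∑ x', μ x' ^ 2) * (v y')⁻¹ * (cv * (Real.sqrt (v y) * Real.sqrt (v y'))) :=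
        mul_le_mul_of_nonneg_left hprod hpre2
    _ = cv * Hh * K y y' * (Real.sqrt (v y) * Real.sqrt (v y') * (v y')⁻¹) * Real.sqrt (∑ x', μ x' ^ 2) := by ring
    _ = cv * Hh * K y y' * Real.sqrt (v y / v y') * Real.sqrt (∑ x, μ x ^ 2) := by rw [eS]

/-- **SCHUR + [4] LEMMA 2.1 FOR THE VOLUME WEIGHT: THE PRINTED SHAPE OF (3.46).**  With a kernel bound `A·w(y)e^{−ρd(y,y′)}v(y′)⁻¹` and the scale
transfer `e^{−αδ₀d(y,y′)}v(y′)^{−1/2} ≦ Λv(y)^{−1/2}` (the p. 398 remark for the weight `v^{−1/2}`), `‖h·Tλ‖₂ ≦ c_vΛA·|h|·w(y)·e^{−ρ′d(y,y′)}‖λ‖₂` for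
`ρ′ + αδ₀ ≦ ρ`. [cite: Balaban1985BackgroundPropagators, (3.46) p.398 + p.398 remark; Balaban1984PropagatorsII, Lemma 2.1 p.234 (bookkeeping ours)] -/
theorem l2_block_of_kernelBound_transfer (blk : X → g.Site) {v : g.Site → ℝ} (hv : ∀ y, 0 < v y) {c cv : ℝ} (hc : 0 < c)
    (hvol : ∀ y : g.Site, c * ((Finset.univ.filter (fun x : X => blk x = y)).card : ℝ) ≤ cv * v y)
    {δ₀ α Λ ρ ρ' A : ℝ} (hA : 0 ≤ A) (hρ' : ρ' + α * δ₀ ≤ ρ)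
    (hdnn : ∀ a a' : g.Site, 0 ≤ g.dist a a')
    (hT : ScaleTransfer g δ₀ α Λ (fun a => (Real.sqrt (v a))⁻¹)) {w : g.Site → ℝ} (hw : ∀ a, 0 ≤ w a)
    {T : Module.End ℝ (X → ℝ)} (h : HasKernelBound (g := toB6 g R H) blk v c T (fun a a' => A * w a * Real.exp (-(ρ * g.dist a a'))))
    (y y' : g.Site) (hf μ : X → ℝ) (Hh : ℝ) (hHh : 0 ≤ Hh) (hh : ∀ x, |hf x| ≤ Hh) (hh0 : ∀ x, blk x ≠ y → hf x = 0)
    (hμ0 : ∀ x, blk x ≠ y' → μ x = 0) :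
    Real.sqrt (∑ x, (hf x * T μ x) ^ 2) ≤ cv * Λ * A * Hh * w y * Real.exp (-(ρ' * g.dist y y')) * Real.sqrt (∑ x, μ x ^ 2) := by
  have hK : ∀ a a', 0 ≤ A * w a * Real.exp (-(ρ * g.dist a a')) := fun a a' => mul_nonneg (mul_nonneg hA (hw a)) (Real.exp_nonneg _)
  have h1 := l2_block_of_kernelBound (R := R) (H := H) blk hv hc hvol hK h y y' hf μ Hh hHh hh hh0 hμ0
  refine h1.trans ?_
  have hvy : 0 < v y := hv y
  have hvy' : 0 < v y' := hv y'
  have hN : 0 ≤ Real.sqrt (∑ x, μ x ^ 2) := Real.sqrt_nonneg _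
  have hcv : 0 ≤ cv := by
    have h4 : 0 ≤ c * ((Finset.univ.filter (fun x : X => blk x = y)).card : ℝ) := by positivity
    have h0 : 0 * v y ≤ cv * v y := by rw [zero_mul]; exact h4.trans (hvol y)
    exact le_of_mul_le_mul_right h0 hvy
  -- the transfer: `√(v(y)/v(y′))·e^{−αδ₀d(y,y′)} ≦ Λ`
  have ht := hT y y'
  have hsq : 0 < Real.sqrt (v y) := Real.sqrt_pos.mpr hvy
  have hratio : Real.sqrt (v y / v y') * Real.exp (-(α * δ₀ * g.dist y y')) ≤ Λ := by
    rw [Real.sqrt_div' (v y) hvy'.le]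
    have e : Real.sqrt (v y) / Real.sqrt (v y') * Real.exp (-(α * δ₀ * g.dist y y')) =
        Real.sqrt (v y) * (Real.exp (-(α * δ₀ * g.dist y y')) * (Real.sqrt (v y'))⁻¹) := by ring
    rw [e]
    calc Real.sqrt (v y) * (Real.exp (-(α * δ₀ * g.dist y y')) * (Real.sqrt (v y'))⁻¹)
        ≤ Real.sqrt (v y) * (Λ * (Real.sqrt (v y))⁻¹) := mul_le_mul_of_nonneg_left ht hsq.le
      _ = Λ := by rw [mul_comm Λ, ← mul_assoc, mul_inv_cancel₀ hsq.ne', one_mul]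
  -- split the rate `ρ = (ρ − ρ′) + ρ′ ≧ αδ₀ + ρ′`
  have hexp : Real.exp (-(ρ * g.dist y y')) ≤ Real.exp (-(α * δ₀ * g.dist y y')) * Real.exp (-(ρ' * g.dist y y')) := by
    rw [← Real.exp_add]
    refine Real.exp_le_exp.mpr ?_
    have hd := hdnn y y'
    nlinarith
  have hE : 0 ≤ Real.exp (-(ρ' * g.dist y y')) := Real.exp_nonneg _
  calc cv * Hh * (A * w y * Real.exp (-(ρ * g.dist y y'))) * Real.sqrt (v y / v y') * Real.sqrt (∑ x, μ x ^ 2)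
      ≤ cv * Hh * (A * w y * (Real.exp (-(α * δ₀ * g.dist y y')) * Real.exp (-(ρ' * g.dist y y')))) * Real.sqrt (v y / v y') *
          Real.sqrt (∑ x, μ x ^ 2) := by
        have hp : 0 ≤ cv * Hh := mul_nonneg hcv hHh
        have hq : 0 ≤ A * w y := mul_nonneg hA (hw y)
        have := mul_le_mul_of_nonneg_left hexp hq
        exact mul_le_mul_of_nonneg_right (mul_le_mul_of_nonneg_right (mul_le_mul_of_nonneg_left this hp) (Real.sqrt_nonneg _)) hN
    _ = cv * A * Hh * w y * Real.exp (-(ρ' * g.dist y y')) * Real.sqrt (∑ x, μ x ^ 2) *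
          (Real.sqrt (v y / v y') * Real.exp (-(α * δ₀ * g.dist y y'))) := by ring
    _ ≤ cv * A * Hh * w y * Real.exp (-(ρ' * g.dist y y')) * Real.sqrt (∑ x, μ x ^ 2) * Λ := by
        refine mul_le_mul_of_nonneg_left hratio ?_
        exact mul_nonneg (mul_nonneg (mul_nonneg (mul_nonneg (mul_nonneg hcv hA) hHh) (hw y)) hE) hN
    _ = cv * Λ * A * Hh * w y * Real.exp (-(ρ' * g.dist y y')) * Real.sqrt (∑ x, μ x ^ 2) := by ring

end Schur

/-! ## §2  THEOREM 3.4 × THEOREM 3.1: THE `L²` MEMBERS (3.46)₁,₂,₃,₅ FOR THE CONCRETE `G′(U′U)` OF (3.64), PRINTED QUANTIFIERS -/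

section FinalGp

variable {𝔸 : Type*} [NormedRing 𝔸] [NormedAlgebra ℂ 𝔸] [CompleteSpace 𝔸] {ι : Type} [Fintype ι]
variable (b : Module.Basis ι ℝ 𝔸) {S : Type} {κ : Type} [Fintype κ]
variable (T : κ → Equiv.Perm S) (U : κ → S → 𝔸ˣ)
variable {g : B9.Geometry} [Fintype g.Site] {Rr : ℝ} {H : Prop}

set_option maxHeartbeats 800000 in
/-- **THEOREM 3.4 × THEOREM 3.1: THE `L²` MEMBERS (3.46)₁,₂,₃,₅ FOR THE CONCRETE `G′(U′U) = G′(U)(I − V′(A)G′(U))⁻¹` OF (3.64)** («Finally, we have the inequalities in L²-norms ‖hG′(U)λ‖, ‖h∇_UG′(U)λ‖, ‖hG′(U)∇*_Uλ‖, ‖h∇_U∇_UG′(U)λ‖, ‖h∇_UG′(U)∇*_Uλ‖, ‖hG′(U)∇*_U∇*_Uλ‖ ≦ B₀[(Lʲη)², Lʲη, Lʲη, 1, 1, 1]|h|e^{−δ₀d(y,y′)}‖λ‖ for supp h ⊂ Δ(y), y ∈ Λ_j, supp λ ⊂ Δ(y′); (3.46)»; for `U′U`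
by Theorem 3.4 p. 400 and p. 403 l. 2–5).  HYPOTHESES = FILE 16 `thm34_Gp_kernel_final` VERBATIM + the block volumes `c·#Δ(y) ≦ c_v v(y)` + [4] Lemma 2.1
for the weight `v^{−1/2}`.  CONCLUSION `∃ a₁ > 0 ∃ B ≧ 0 ∀ α₁ ≦ a₁ ∀ A kF sF …` (FILE 16's premises verbatim): `G′(U′U)` is the two-sided inverse of
`Δ′_a(U) − V′(A)` (re-exported) ∧ `∀ y y′ ∀ h` (`|h| ≦ H`, `supp h ⊂ Δ(y)`) `∀ λ` (`supp λ ⊂ Δ(y′)`): `‖hG′(U′U)λ‖₂ ≦ BH(Lʲη)²e^{−(3δ₀/4)d(y,y′)}‖λ‖₂`,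
`‖h∇_kG′(U′U)λ‖₂ ≦ BH(Lʲη)e^{−(3δ₀/4)d}‖λ‖₂`, `‖hG′(U′U)∇_lλ‖₂ ≦ BH(Lʲη)e^{−(3δ₀/4)d}‖λ‖₂`, `‖h∇_kG′(U′U)∇_lλ‖₂ ≦ BHe^{−(3δ₀/4)d}‖λ‖₂`.  PROOF: FILE 16's four
kernel entries of `G′(U′U)` (rate `4δ₀/5`), §1 `l2_block_of_kernelBound_transfer` at `α = 1/20`; `B = c_vΛ_vB₁₆`.  HONEST SCOPE: module header (a)–(f)
((3.46)₄,₆ not covered; counting `ℓ²` norms of the real coordinates).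
[cite: Balaban1985BackgroundPropagators, Thm 3.4 p.400 + Thm 3.1 (3.42)/(3.46) pp.397–398 + p.398 remark + p.393 + (3.64) p.402 + p.403 l.2–5; Balaban1984PropagatorsII, (2.64)–(2.66) p.234 + Lemma 2.1 p.234] -/
theorem thm34_Gp_l2_final [Fintype S] [DecidableEq S] [DecidableEq ι] [DecidableEq g.Site] [Nonempty g.Site] (blk : S → g.Site) (d : ℕ)
    (δ₀ BG Cq a₀ d₀ M₂ : ℝ)
    (kQ : g.Site → S → 𝔸 →L[ℝ] 𝔸) (sQ : S → 𝔸 →L[ℝ] 𝔸) (cfun w : g.Site → ℝ)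
    (hBG : 0 < BG) (hCq : 0 ≤ Cq) (ha₀ : 0 ≤ a₀) (hM₂ : 0 ≤ M₂) (hδ₀ : 0 < δ₀)
    -- the multiscale geometry 𝔅 (p. 393, [4] (2.1)–(2.4)) and its axioms
    (hdnn : ∀ a a' : g.Site, 0 ≤ g.dist a a') (htri : Triangle254 (toB6 g Rr H)) (hrefl : ∀ y : g.Site, g.dist y y = 0)
    (hsym : ∀ y y' : g.Site, g.dist y y' = g.dist y' y) (hlen : ∀ y : g.Site, 0 < g.len y) (hlenη : ∀ y : g.Site, g.eta ≤ g.len y)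
    (hη : 0 < g.eta)
    -- [4] Lemma 2.1 (2.61) at the rate `δ₀`, «for every 0 < α < 1», and the p. 398 scale transfer for every exponent
    (h261 : ∀ α : ℝ, 0 < α → α < 1 → Ineq261 d (toB6 g Rr H) δ₀ α)
    (hST : ∀ α : ℝ, 0 < α → ∃ Λ : ℝ, 1 ≤ Λ ∧ ScaleTransfer g δ₀ α Λ (fun a => g.len a) ∧ ScaleTransfer g δ₀ α Λ (fun a => g.len a ^ 2) ∧
      ScaleTransfer g δ₀ α Λ (fun a => (g.len a)⁻¹) ∧ ScaleTransfer g δ₀ α Λ (fun a => (g.len a ^ 2)⁻¹) ∧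
      ScaleTransfer g δ₀ α Λ (fun a => (g.len a ^ 4)⁻¹) ∧ ScaleTransfer g δ₀ α Λ (fun y => g.len y ^ (-(4 : ℝ))))
    (hrepr : ∀ (v : 𝔸) (i : ι), |b.repr v i| ≤ M₂ * ‖v‖)
    (hU1 : ∀ m z, ‖((U m z : 𝔸ˣ) : 𝔸)‖ ≤ 1 ∧ ‖(((U m z)⁻¹ : 𝔸ˣ) : 𝔸)‖ ≤ 1)
    (hd₀B : ∀ μ x, g.dist (blk x) (blk ((T μ).symm x)) ≤ d₀) (hd₀F : ∀ μ x, g.dist (blk x) (blk (T μ x)) ≤ d₀)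
    (hd₀0 : ∀ y : g.Site, g.dist y y ≤ d₀)
    -- the `A`-independent data of the concrete `V′(A)` of (3.60)
    (hw : ∀ y, 0 ≤ w y) (hcard : ∀ y, ((B9Eq360Vprime.block blk y).card : ℝ) * w y ≤ 1)
    (hkQ : ∀ y x, blk x = y → ‖kQ y x‖ ≤ w y) (hsQ : ∀ x, ‖sQ x‖ ≤ 1) (hcfun : ∀ y, |cfun y| ≤ a₀ * (g.len y ^ 2)⁻¹)
    -- THEOREM 3.1 for `G′(U)`: (3.24) `G′(U) = (Δ′_a(U))⁻¹` for the letter `Δ′_a(U)`, and (3.42)₁,₂,₃ at the rate `δ₀`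
    {Δp Gp : Module.End ℝ (S × ι → ℝ)} (hΔpGp : Δp * Gp = 1) (hGpΔp : Gp * Δp = 1)
    (h342_1 : HasMajorant (g := toB6 g Rr H) (fun p : S × ι => blk p.1) Gp
      (fun a a' => BG * g.len a ^ 2 * Real.exp (-(δ₀ * g.dist a a'))))
    (h342_2 : ∀ k : κ ⊕ κ, HasMajorant (g := toB6 g Rr H) (fun p : S × ι => blk p.1)
      (conj b (diffLetter T U ((g.eta : ℂ)⁻¹) k) * Gp) (fun a a' => BG * g.len a * Real.exp (-(δ₀ * g.dist a a'))))
    (h342_3 : ∀ k : κ ⊕ κ, HasMajorant (g := toB6 g Rr H) (fun p : S × ι => blk p.1)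
      (Gp * conj b (diffLetter T U ((g.eta : ℂ)⁻¹) k)) (fun a a' => BG * g.len a * Real.exp (-(δ₀ * g.dist a a'))))
    -- the kernel pairing of p. 393 (`c = η^d`, block volume weight `v(y′) = (L^{j′}η)^d`) and THEOREM 3.1's (3.42)₁₋₄ FOR `G′(U)` IN THE PRINTED KERNEL FORM
    {v : g.Site → ℝ} (hv : ∀ y, 0 < v y) {cK : ℝ} (hcK : 0 < cK)
    (hGpk : HasKernelBound (g := toB6 g Rr H) (fun p : S × ι => blk p.1) v cK Gp
      (fun a a' => BG * g.len a ^ 2 * Real.exp (-(δ₀ * g.dist a a'))))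
    (hDGpk : ∀ k : κ ⊕ κ, HasKernelBound (g := toB6 g Rr H) (fun p : S × ι => blk p.1) v cK
      (conj b (diffLetter T U ((g.eta : ℂ)⁻¹) k) * Gp) (fun a a' => BG * g.len a * Real.exp (-(δ₀ * g.dist a a'))))
    (hGpDk : ∀ l : κ ⊕ κ, HasKernelBound (g := toB6 g Rr H) (fun p : S × ι => blk p.1) v cK
      (Gp * conj b (diffLetter T U ((g.eta : ℂ)⁻¹) l)) (fun a a' => BG * g.len a * Real.exp (-(δ₀ * g.dist a a'))))
    (hDGpDk : ∀ k l : κ ⊕ κ, HasKernelBound (g := toB6 g Rr H) (fun p : S × ι => blk p.1) v cK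
      (conj b (diffLetter T U ((g.eta : ℂ)⁻¹) k) * Gp * conj b (diffLetter T U ((g.eta : ℂ)⁻¹) l)) (fun a a' => BG * Real.exp (-(δ₀ * g.dist a a'))))
    -- NEW: the block volumes in the kernel pairing (p. 393) and [4] Lemma 2.1 for the block-volume weight `v^{−1/2}` (p. 398 remark)
    (cv : ℝ) (hvol : ∀ y : g.Site, cK * ((Finset.univ.filter (fun p : S × ι => blk p.1 = y)).card : ℝ) ≤ cv * v y)
    (hSTv : ∀ α : ℝ, 0 < α → ∃ Λ : ℝ, 1 ≤ Λ ∧ ScaleTransfer g δ₀ α Λ (fun y => (Real.sqrt (v y))⁻¹)) :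
    ∃ a₁ : ℝ, 0 < a₁ ∧ ∃ B : ℝ, 0 ≤ B ∧
    ∀ (α₁ : ℝ), 0 ≤ α₁ → α₁ ≤ a₁ →
    -- the exponent field `A` in the domain (3.37), read blockwise, and the `A`-dependent (3.59) data `kF`, `sF`
    ∀ (A : κ → S → 𝔸) (kF : g.Site → S → 𝔸 →L[ℝ] 𝔸) (sF : S → 𝔸 →L[ℝ] 𝔸),
      (∀ y x, blk x = y → ‖kF y x‖ ≤ Cq * α₁ * w y) → (∀ x, ‖sF x‖ ≤ Cq * α₁) →
      (∀ ν k x, ‖((g.eta : ℂ)⁻¹) • covDstar T U ν (A k) x‖ ≤ α₁ * (g.len (blk x) ^ 2)⁻¹) →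
      (∀ μ ν x, ‖((g.eta : ℂ)⁻¹) • covD T U μ (A ν) x‖ ≤ α₁ * (g.len (blk x) ^ 2)⁻¹) →
      (∀ μ x, ‖((g.eta : ℂ)⁻¹) • covDstar T U μ (tauB T U μ (A μ)) x‖ ≤ α₁ * (g.len (blk x) ^ 2)⁻¹) →
      (∀ k x, ‖A k x‖ ≤ α₁ * (g.len (blk x))⁻¹) → (∀ ν k x, ‖tauB T U ν (A k) x‖ ≤ α₁ * (g.len (blk x))⁻¹) →
      -- (i) `G′(U′U)` = the two-sided inverse of `Δ′_a(U) − V′(A)` (FILE 16/26, re-exported)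
      (Δp - (conj b (vPrimeConc T U g.eta A blk kQ kF sQ sF cfun))) * (gPrimeExtEnd Gp (conj b (vPrimeConc T U g.eta A blk kQ kF sQ sF cfun) * Gp)) = 1 ∧
      (gPrimeExtEnd Gp (conj b (vPrimeConc T U g.eta A blk kQ kF sQ sF cfun) * Gp)) * (Δp - (conj b (vPrimeConc T U g.eta A blk kQ kF sQ sF cfun))) = 1 ∧
      -- (vii′) NEW: the `L²` members (3.46)₁,₂,₃,₅ of Theorem 3.1 for `G′(U′U)`
      (∀ (y y' : g.Site) (hf μ : S × ι → ℝ) (Hh : ℝ), 0 ≤ Hh → (∀ x, |hf x| ≤ Hh) → (∀ x, blk x.1 ≠ y → hf x = 0) →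
        (∀ x, blk x.1 ≠ y' → μ x = 0) →
        Real.sqrt (∑ x, (hf x * (gPrimeExtEnd Gp (conj b (vPrimeConc T U g.eta A blk kQ kF sQ sF cfun) * Gp)) μ x) ^ 2) ≤ B * Hh * g.len y ^ 2 * Real.exp (-(3 / 4 * δ₀ * g.dist y y')) * Real.sqrt (∑ x, μ x ^ 2) ∧
        (∀ k : κ ⊕ κ, Real.sqrt (∑ x, (hf x * ((conj b (diffLetter T U ((g.eta : ℂ)⁻¹) k)) * (gPrimeExtEnd Gp (conj b (vPrimeConc T U g.eta A blk kQ kF sQ sF cfun) * Gp))) μ x) ^ 2) ≤ B * Hh * g.len y * Real.exp (-(3 / 4 * δ₀ * g.dist y y')) * Real.sqrt (∑ x, μ x ^ 2)) ∧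
        (∀ l : κ ⊕ κ, Real.sqrt (∑ x, (hf x * ((gPrimeExtEnd Gp (conj b (vPrimeConc T U g.eta A blk kQ kF sQ sF cfun) * Gp)) * (conj b (diffLetter T U ((g.eta : ℂ)⁻¹) l))) μ x) ^ 2) ≤ B * Hh * g.len y * Real.exp (-(3 / 4 * δ₀ * g.dist y y')) * Real.sqrt (∑ x, μ x ^ 2)) ∧
        (∀ k l : κ ⊕ κ, Real.sqrt (∑ x, (hf x * ((conj b (diffLetter T U ((g.eta : ℂ)⁻¹) k)) * (gPrimeExtEnd Gp (conj b (vPrimeConc T U g.eta A blk kQ kF sQ sF cfun) * Gp)) * (conj b (diffLetter T U ((g.eta : ℂ)⁻¹) l))) μ x) ^ 2) ≤ B * Hh * Real.exp (-(3 / 4 * δ₀ * g.dist y y')) * Real.sqrt (∑ x, μ x ^ 2))) := by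
  classical
  obtain ⟨y₀⟩ := ‹Nonempty g.Site›
  obtain ⟨a₁, ha₁, B', hB', H16⟩ := thm34_Gp_kernel_final (Rr := Rr) (H := H) b T U blk d δ₀ BG Cq a₀ d₀ M₂ kQ sQ cfun w hBG hCq ha₀ hM₂ hδ₀
    hdnn htri hrefl hsym hlen hlenη hη h261 hST hrepr hU1 hd₀B hd₀F hd₀0 hw hcard hkQ hsQ hcfun hΔpGp hGpΔp h342_1 h342_2 h342_3 hv hcK hGpk hDGpk
    hGpDk hDGpDk
  obtain ⟨Λ, hΛ1, hTv⟩ := hSTv (1 / 20) (by norm_num)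
  have hcv : 0 ≤ cv := by
    have h4 : 0 ≤ cK * ((Finset.univ.filter (fun p : S × ι => blk p.1 = y₀)).card : ℝ) := by positivity
    have h0 : 0 * v y₀ ≤ cv * v y₀ := by rw [zero_mul]; exact h4.trans (hvol y₀)
    exact le_of_mul_le_mul_right h0 (hv y₀)
  refine ⟨a₁, ha₁, cv * Λ * B', mul_nonneg (mul_nonneg hcv (zero_le_one.trans hΛ1)) hB', ?_⟩
  intro α₁ hα₁0 hα₁1 A kF sF hkF hsF h337B h337F h337Bτ hA hAτB
  obtain ⟨e1, e2, K1, K2, K3, K4⟩ := H16 α₁ hα₁0 hα₁1 A kF sF hkF hsF h337B h337F h337Bτ hA hAτB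
  have hρ' : 3 / 4 * δ₀ + 1 / 20 * δ₀ ≤ 4 / 5 * δ₀ := by linarith only [hδ₀]
  have hw2 : ∀ a : g.Site, 0 ≤ g.len a ^ 2 := fun a => sq_nonneg _
  have hw1 : ∀ a : g.Site, 0 ≤ g.len a := fun a => (hlen a).le
  have hw0 : ∀ _a : g.Site, (0 : ℝ) ≤ 1 := fun _ => zero_le_one
  refine ⟨e1, e2, ?_⟩
  intro y y' hf μ Hh hHh hh hh0 hμ0
  refine ⟨?_, ?_, ?_, ?_⟩
  · simpa only using l2_block_of_kernelBound_transfer (R := Rr) (H := H) (fun p : S × ι => blk p.1) hv hcK hvol hB' hρ' hdnn hTv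
      (w := fun a => g.len a ^ 2) hw2 K1 y y' hf μ Hh hHh hh hh0 hμ0
  · intro k
    simpa only using l2_block_of_kernelBound_transfer (R := Rr) (H := H) (fun p : S × ι => blk p.1) hv hcK hvol hB' hρ' hdnn hTv
      (w := fun a => g.len a) hw1 (K2 k) y y' hf μ Hh hHh hh hh0 hμ0
  · intro l
    simpa only using l2_block_of_kernelBound_transfer (R := Rr) (H := H) (fun p : S × ι => blk p.1) hv hcK hvol hB' hρ' hdnn hTv
      (w := fun a => g.len a) hw1 (K3 l) y y' hf μ Hh hHh hh hh0 hμ0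
  · intro k l
    have K4' := hasKernelBound_mono (g := toB6 g Rr H) (fun p : S × ι => blk p.1) hv (K4 k l)
      (K' := fun a a' => B' * (1 : ℝ) * Real.exp (-(4 / 5 * δ₀ * g.dist a a'))) fun a a' => le_of_eq (by ring)
    simpa only [mul_one] using l2_block_of_kernelBound_transfer (R := Rr) (H := H) (fun p : S × ι => blk p.1) hv hcK hvol hB' hρ' hdnn hTv
      (w := fun _ => (1 : ℝ)) hw0 K4' y y' hf μ Hh hHh hh hh0 hμ0

end FinalGp

/-! ## §3  THEOREM 3.4 × THEOREM 3.3: THE `L²` MEMBERS (3.46)₁,₂,₃,₅ FOR THE `G(U′U)` OF FILE 28, PRINTED QUANTIFIERS -/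

section FinalG

variable {𝔸 : Type*} [NormedRing 𝔸] [NormedAlgebra ℂ 𝔸] [CompleteSpace 𝔸] {ι : Type} [Fintype ι]
variable (b : Module.Basis ι ℝ 𝔸) {S : Type} {κ : Type} [Fintype κ] [LinearOrder κ]
variable (T : κ → Equiv.Perm S) (U : κ → S → 𝔸ˣ)
variable {g : B9.Geometry} [Fintype g.Site] {Rr : ℝ} {H : Prop}

set_option maxHeartbeats 1600000 in
/-- **THEOREM 3.4 × THEOREM 3.3: THE `L²` MEMBERS (3.46)₁,₂,₃,₅ FOR THE `G(U′U)` OF FILE 28** (Theorem 3.3 p. 399 «with G′(U) replaced by G(U) and λ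
replaced by a function J defined at bonds»; «Finally, we have the inequalities in L²-norms ‖hG′(U)λ‖, ‖h∇_UG′(U)λ‖, ‖hG′(U)∇*_Uλ‖, ‖h∇_U∇_UG′(U)λ‖, ‖h∇_UG′(U)∇*_Uλ‖, ‖hG′(U)∇*_U∇*_Uλ‖ ≦ B₀[(Lʲη)², Lʲη, Lʲη, 1, 1, 1]|h|e^{−δ₀d(y,y′)}‖λ‖ for supp h ⊂ Δ(y), y ∈ Λ_j, supp λ ⊂ Δ(y′); (3.46)»; for `U′U` by Theorem 3.4 p. 400 and p. 407).  HYPOTHESES = FILE 28 `thm34_all_final` VERBATIM + the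
block volumes of the bond carrier in the pairing + [4] Lemma 2.1 for `v^{−1/2}`.  CONCLUSION `∃ a₁ > 0 ∃ B ≧ 0 ∀ α₁ ≦ a₁ ∀ A …` (FILE 28's premises verbatim)
`∃ C⁻¹(U′U), G(U′U)` — FILE 28's pair ((ii)/(iii) defining identities re-exported) — with, for all `y, y′`, `h` (`|h| ≦ H`, `supp h ⊂ Δ(y)`), `J` (`supp J ⊂
Δ(y′)`): `‖hG(U′U)J‖₂ ≦ BH(Lʲη)²e^{−(δ₀/20)d(y,y′)}‖J‖₂`, `‖h∇_kG(U′U)J‖₂, ‖hG(U′U)∇_lJ‖₂ ≦ BH(Lʲη)e^{−(δ₀/20)d}‖J‖₂`, `‖h∇_kG(U′U)∇_lJ‖₂ ≦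
BHe^{−(δ₀/20)d}‖J‖₂`.  PROOF: FILE 28's four kernel entries of `G(U′U)` (rate `δ₀/10`), §1 at `α = 1/20`; `B = c_vΛ_vB₂₈`.  HONEST SCOPE: module header (a)–(f).
[cite: Balaban1985BackgroundPropagators, Thm 3.4 p.400 + Thm 3.3 p.399 + Thm 3.1 (3.42)/(3.46) pp.397–398 + p.398 remark + p.393 + (3.84)–(3.86) p.407; Balaban1984PropagatorsII, (2.64)–(2.66) p.234 + Lemma 2.1 p.234] -/
theorem thm34_G_l2_final [Fintype S] [DecidableEq S] [DecidableEq ι] [DecidableEq g.Site] [Nonempty g.Site] (blk : S → g.Site) (d : ℕ)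
    (δ₀ B₀ κQ BG B₁ cF Cq a₀ C₀ d₀ M₂ κQb cFb abar : ℝ)
    (kQ : g.Site → S → 𝔸 →L[ℝ] 𝔸) (sQ : S → 𝔸 →L[ℝ] 𝔸) (cfun w : g.Site → ℝ)
    (hB₀ : 0 ≤ B₀) (hκQ : 0 < κQ) (hBG : 0 < BG) (hB₁ : 0 < B₁) (hcF : 0 < cF) (hCq : 0 ≤ Cq) (ha₀ : 0 ≤ a₀) (hC₀ : 0 ≤ C₀)
    (hM₂ : 0 ≤ M₂) (hδ₀ : 0 < δ₀) (hκQb : 0 ≤ κQb) (hcFb : 0 ≤ cFb) (habar : 0 ≤ abar)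
    -- the multiscale geometry 𝔅 (p. 393, [4] (2.1)–(2.4)) and its axioms
    (hdnn : ∀ a a' : g.Site, 0 ≤ g.dist a a') (htri : Triangle254 (toB6 g Rr H)) (hrefl : ∀ y : g.Site, g.dist y y = 0)
    (hsym : ∀ y y' : g.Site, g.dist y y' = g.dist y' y) (hlen : ∀ y : g.Site, 0 < g.len y) (hlenη : ∀ y : g.Site, g.eta ≤ g.len y)
    (hη : 0 < g.eta) (hL : 1 ≤ g.L)
    -- [4] Lemma 2.1 (2.61) at the rate `δ₀`, «for every 0 < α < 1»
    (h261 : ∀ α : ℝ, 0 < α → α < 1 → Ineq261 d (toB6 g Rr H) δ₀ α)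
    -- p. 398: «Using Lemma 2.1 in [4] we may replace the factor (Lʲη)^α by (Lʲη)^β(L^{j′}η)^γ with β + γ = α» — for every exponent, one
    -- constant `Λ(α) ≧ 1` for the six weights `(Lʲη)^{1,2,−1,−2,−4}` (natural and real powers)
    (hST : ∀ α : ℝ, 0 < α → ∃ Λ : ℝ, 1 ≤ Λ ∧ ScaleTransfer g δ₀ α Λ (fun a => g.len a) ∧ ScaleTransfer g δ₀ α Λ (fun a => g.len a ^ 2) ∧
      ScaleTransfer g δ₀ α Λ (fun a => (g.len a)⁻¹) ∧ ScaleTransfer g δ₀ α Λ (fun a => (g.len a ^ 2)⁻¹) ∧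
      ScaleTransfer g δ₀ α Λ (fun a => (g.len a ^ 4)⁻¹) ∧ ScaleTransfer g δ₀ α Λ (fun y => g.len y ^ (-(4 : ℝ))))
    -- real coordinates of `𝔸`, commuting translations, unitary-type background
    (hrepr : ∀ (v : 𝔸) (i : ι), |b.repr v i| ≤ M₂ * ‖v‖) (hT : ∀ (μ ν : κ) (x : S), T μ (T ν x) = T ν (T μ x))
    (hU1 : ∀ m z, ‖((U m z : 𝔸ˣ) : 𝔸)‖ ≤ 1 ∧ ‖(((U m z)⁻¹ : 𝔸ˣ) : 𝔸)‖ ≤ 1)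
    -- (3.35) on the plaquettes through each bond, at that bond's block scale; stencil geometry at range `d₀`
    (h35 : ∀ μ x m n y, Through T μ x m n y → ‖(plaqU T U m n y : 𝔸) - 1‖ ≤ C₀ * ((g.L ^ g.scale (blk x))⁻¹) ^ 2)
    (hd₀B : ∀ μ x, g.dist (blk x) (blk ((T μ).symm x)) ≤ d₀) (hd₀F : ∀ μ x, g.dist (blk x) (blk (T μ x)) ≤ d₀)
    (hd₀FB : ∀ μ ν x, g.dist (blk x) (blk ((T ν).symm (T μ x))) ≤ d₀)
    (hd₀st : ∀ μ x (q : κ × S), q ∈ stBonds T μ x → g.dist (blk x) (blk q.2) ≤ d₀)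
    (hd₀loc : ∀ μ x (q : κ × S), q ∈ B9Eq375Locality.locBondsA' T μ x → g.dist (blk x) (blk q.2) ≤ d₀)
    (hd₀0 : ∀ y : g.Site, g.dist y y ≤ d₀)
    -- the `A`-independent data of the concrete `V′(A)` of (3.60): (3.19) kernels/multipliers and the `a`-weights of (3.24)
    (hw : ∀ y, 0 ≤ w y) (hcard : ∀ y, ((B9Eq360Vprime.block blk y).card : ℝ) * w y ≤ 1)
    (hkQ : ∀ y x, blk x = y → ‖kQ y x‖ ≤ w y) (hsQ : ∀ x, ‖sQ x‖ ≤ 1) (hcfun : ∀ y, |cfun y| ≤ a₀ * (g.len y ^ 2)⁻¹)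
    -- THEOREM 3.1 for `G′(U)`: (3.42)₁,₂,₃ at the rate `δ₀`
    {Gp : Module.End ℝ (S × ι → ℝ)}
    (h342_1 : HasMajorant (g := toB6 g Rr H) (fun p : S × ι => blk p.1) Gp
      (fun a a' => BG * g.len a ^ 2 * Real.exp (-(δ₀ * g.dist a a'))))
    (h342_2 : ∀ k : κ ⊕ κ, HasMajorant (g := toB6 g Rr H) (fun p : S × ι => blk p.1)
      (conj b (diffLetter T U ((g.eta : ℂ)⁻¹) k) * Gp) (fun a a' => BG * g.len a * Real.exp (-(δ₀ * g.dist a a'))))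
    (h342_3 : ∀ k : κ ⊕ κ, HasMajorant (g := toB6 g Rr H) (fun p : S × ι => blk p.1)
      (Gp * conj b (diffLetter T U ((g.eta : ℂ)⁻¹) k)) (fun a a' => BG * g.len a * Real.exp (-(δ₀ * g.dist a a'))))
    -- (3.24): `G′(U) = (Δ′_a(U))⁻¹` for the letter `Δ′_a(U)`
    {Δp : Module.End ℝ (S × ι → ℝ)} (hΔpGp : Δp * Gp = 1) (hGpΔp : Gp * Δp = 1)
    -- the (3.19) letters `Q′(U)`, `Q′*(U)` in their own typing with block-local two-space majorants, a section of the block map (FILE 17)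
    (rep : g.Site → S × ι) (hrep : ∀ y : g.Site, blk (rep y).1 = y)
    {Qc : (S × ι → ℝ) →ₗ[ℝ] (g.Site → ℝ)} {Qcs : (g.Site → ℝ) →ₗ[ℝ] (S × ι → ℝ)} {Linv : Module.End ℝ (g.Site → ℝ)}
    (hQc : HasMajorantHom (g := toB6 g Rr H) (fun p : S × ι => blk p.1) (fun y : g.Site => y) Qc
      (fun a a' : g.Site => κQ * (if a = a' then (1 : ℝ) else 0)))
    (hQcs : HasMajorantHom (g := toB6 g Rr H) (fun y : g.Site => y) (fun p : S × ι => blk p.1) Qcs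
      (fun a a' : g.Site => κQ * (if a = a' then (1 : ℝ) else 0)))
    -- THEOREM 3.2 for `U`: (3.21) `C⁻¹ = (Q′G′²Q′*)⁻¹` exists (`hLinv`) with the KERNEL bound (3.48) at the rate `δ₀`
    (hLinv : (Qc ∘ₗ (Gp * Gp) ∘ₗ Qcs) * Linv = 1)
    (h348 : ∀ y y' : g.Site, |B9Thm34Inv.ker (B9Thm34Inv.vol g d) Linv y y'| ≤
      B₁ * g.len y ^ (-(4 : ℝ)) * g.len y' ^ (-(d : ℝ)) * Real.exp (-(δ₀ * g.dist y y')))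
    -- the (3.15) bond letters `Q(U)`, `Q*(U)` and the weight letter `a` of (3.24)/(3.26), with their majorants
    {G Qs Q a : Module.End ℝ ((κ × S) × ι → ℝ)}
    (hQb : HasMajorant (g := toB6 g Rr H) (fun q : (κ × S) × ι => blk q.1.2) Q (fun a a' => κQb * Real.exp (-(δ₀ * g.dist a a'))))
    (hQsb : HasMajorant (g := toB6 g Rr H) (fun q : (κ × S) × ι => blk q.1.2) Qs (fun a a' => κQb * Real.exp (-(δ₀ * g.dist a a'))))
    (ha324 : HasMajorant (g := toB6 g Rr H) (fun q : (κ × S) × ι => blk q.1.2) a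
      (fun a a' : g.Site => if a = a' then abar * (g.len a ^ 2)⁻¹ else 0))
    -- THEOREM 3.3 for `G(U)`: two-sided inverse of the concrete `Δ_a(U)` and its (3.42)-entries at the rate `δ₀`
    (hΔG : deltaA (conj b (lapDDLetter T ((g.eta : ℂ)⁻¹) U)) (conj b (dPrimeLetter T U g.eta))
      (conjHom b (gradLin T ((g.eta : ℂ)⁻¹) U) ∘ₗ (1 - (Gp ∘ₗ Qcs ∘ₗ Linv ∘ₗ Qc ∘ₗ Gp)) ∘ₗ conjHom b (divLin T ((g.eta : ℂ)⁻¹) U)) Qs a Q * G = 1)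
    (hGΔ : G * deltaA (conj b (lapDDLetter T ((g.eta : ℂ)⁻¹) U)) (conj b (dPrimeLetter T U g.eta))
      (conjHom b (gradLin T ((g.eta : ℂ)⁻¹) U) ∘ₗ (1 - (Gp ∘ₗ Qcs ∘ₗ Linv ∘ₗ Qc ∘ₗ Gp)) ∘ₗ conjHom b (divLin T ((g.eta : ℂ)⁻¹) U)) Qs a Q = 1)
    (hG : HasMajorant (g := toB6 g Rr H) (fun q : (κ × S) × ι => blk q.1.2) G
      (fun a a' => B₀ * g.len a ^ 2 * Real.exp (-(δ₀ * g.dist a a'))))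
    (hDG : ∀ k : κ ⊕ κ, HasMajorant (g := toB6 g Rr H) (fun q : (κ × S) × ι => blk q.1.2)
      (conj b (diffLetter (bT T) (bU U) ((g.eta : ℂ)⁻¹) k) * G) (fun a a' => B₀ * g.len a * Real.exp (-(δ₀ * g.dist a a'))))
    (hGD : ∀ k : κ ⊕ κ, HasMajorant (g := toB6 g Rr H) (fun q : (κ × S) × ι => blk q.1.2)
      (G * conj b (diffLetter (bT T) (bU U) ((g.eta : ℂ)⁻¹) k)) (fun a a' => B₀ * g.len a * Real.exp (-(δ₀ * g.dist a a'))))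
    -- (kernel form): Theorem 3.3's (3.42)₁,₂,₃,₄ for `G(U)` as PRINTED KERNEL BOUNDS (pairing weight `c = η^d`, volume weight `v(y′) = (L^j′ η)^d`)
    {v : g.Site → ℝ} (hv : ∀ y, 0 < v y) {c : ℝ} (hc : 0 < c)
    (hGk : HasKernelBound (g := toB6 g Rr H) (fun q : (κ × S) × ι => blk q.1.2) v c G
      (fun a a' => B₀ * g.len a ^ 2 * Real.exp (-(δ₀ * g.dist a a'))))
    (hDGk : ∀ k : κ ⊕ κ, HasKernelBound (g := toB6 g Rr H) (fun q : (κ × S) × ι => blk q.1.2) v c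
      (conj b (diffLetter (bT T) (bU U) ((g.eta : ℂ)⁻¹) k) * G) (fun a a' => B₀ * g.len a * Real.exp (-(δ₀ * g.dist a a'))))
    (hGDk : ∀ l : κ ⊕ κ, HasKernelBound (g := toB6 g Rr H) (fun q : (κ × S) × ι => blk q.1.2) v c
      (G * conj b (diffLetter (bT T) (bU U) ((g.eta : ℂ)⁻¹) l)) (fun a a' => B₀ * g.len a * Real.exp (-(δ₀ * g.dist a a'))))
    (hDGDk : ∀ k l : κ ⊕ κ, HasKernelBound (g := toB6 g Rr H) (fun q : (κ × S) × ι => blk q.1.2) v c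
      (conj b (diffLetter (bT T) (bU U) ((g.eta : ℂ)⁻¹) k) * G * conj b (diffLetter (bT T) (bU U) ((g.eta : ℂ)⁻¹) l)) (fun a a' => B₀ * Real.exp (-(δ₀ * g.dist a a'))))
    -- NEW: the block volumes of the bond carrier in the kernel pairing (p. 393) and [4] Lemma 2.1 for the block-volume weight `v^{−1/2}` (p. 398 remark)
    (cv : ℝ) (hvol : ∀ y : g.Site, c * ((Finset.univ.filter (fun q : (κ × S) × ι => blk q.1.2 = y)).card : ℝ) ≤ cv * v y)
    (hSTv : ∀ α : ℝ, 0 < α → ∃ Λ : ℝ, 1 ≤ Λ ∧ ScaleTransfer g δ₀ α Λ (fun y => (Real.sqrt (v y))⁻¹)) :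
    ∃ a₁ : ℝ, 0 < a₁ ∧ ∃ B : ℝ, 0 ≤ B ∧
    ∀ (α₁ : ℝ), 0 ≤ α₁ → α₁ ≤ a₁ →
    -- the exponent field `A` in the domain (3.37), read blockwise in the shapes of FILES 1–19, and the `A`-dependent (3.59) data `kF`, `sF`
    ∀ (A : κ → S → 𝔸) (kF : g.Site → S → 𝔸 →L[ℝ] 𝔸) (sF : S → 𝔸 →L[ℝ] 𝔸),
      (∀ y x, blk x = y → ‖kF y x‖ ≤ Cq * α₁ * w y) → (∀ x, ‖sF x‖ ≤ Cq * α₁) →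
      (∀ ν k x, ‖((g.eta : ℂ)⁻¹) • covDstar T U ν (A k) x‖ ≤ α₁ * (g.len (blk x) ^ 2)⁻¹) →
      (∀ μ ν x, ‖((g.eta : ℂ)⁻¹) • covD T U μ (A ν) x‖ ≤ α₁ * (g.len (blk x) ^ 2)⁻¹) →
      (∀ μ ν x, ‖((g.eta : ℂ)⁻¹) • covDstar T U ν (A ν) (T μ x)‖ ≤ α₁ * (g.len (blk x) ^ 2)⁻¹) →
      (∀ μ x, ‖((g.eta : ℂ)⁻¹) • covDstar T U μ (tauB T U μ (A μ)) x‖ ≤ α₁ * (g.len (blk x) ^ 2)⁻¹) →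
      (∀ μ ν k x, ‖((g.eta : ℂ)⁻¹) • covD T U μ (A k) ((T ν).symm x)‖ ≤ α₁ * (g.len (blk x) ^ 2)⁻¹) →
      (∀ k x, ‖A k x‖ ≤ α₁ * (g.len (blk x))⁻¹) → (∀ ν k x, ‖tauB T U ν (A k) x‖ ≤ α₁ * (g.len (blk x))⁻¹) →
      (∀ μ k x, ‖tauF T U μ (A k) x‖ ≤ α₁ * (g.len (blk x))⁻¹) →
      (∀ k μ ν x, ‖A k ((T ν).symm (T μ x))‖ ≤ α₁ * (g.len (blk x))⁻¹) →
      (∀ μ x m z, (m, z) ∈ stBonds T μ x → ‖A m z‖ ≤ α₁ * (g.len (blk x))⁻¹) →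
      (∀ μ x m z, (m, z) ∈ B9Eq375Locality.locBondsA T μ x → ‖A m z‖ ≤ α₁ * (g.len (blk x))⁻¹) →
      (∀ μ x m n y, Through T μ x m n y →
        ‖covD T U m (A n) y‖ ≤ g.eta * (α₁ * ((g.len (blk x))⁻¹) ^ 2) ∧ ‖covD T U n (A m) y‖ ≤ g.eta * (α₁ * ((g.len (blk x))⁻¹) ^ 2)) →
    -- the (3.57)/(3.59) letters `F′₂(A)`, `F′₂*(A)` (block-local, size `c_F α₁`)
    ∀ {Qc' Fc : (S × ι → ℝ) →ₗ[ℝ] (g.Site → ℝ)} {Qcs' Fcs : (g.Site → ℝ) →ₗ[ℝ] (S × ι → ℝ)},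
      Qc' = Qc + Fc → Qcs' = Qcs + Fcs →
      HasMajorantHom (g := toB6 g Rr H) (fun p : S × ι => blk p.1) (fun y : g.Site => y) Fc
        (fun a a' : g.Site => cF * α₁ * (if a = a' then (1 : ℝ) else 0)) →
      HasMajorantHom (g := toB6 g Rr H) (fun y : g.Site => y) (fun p : S × ι => blk p.1) Fcs
        (fun a a' : g.Site => cF * α₁ * (if a = a' then (1 : ℝ) else 0)) →
    -- the (3.80)–(3.81) letters `F₂(A)`, `F₂*(A)` («|F₂(A)|, |F₂*(A)| ≦ O(1)α₁»), `P₂(A)` of (3.82)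
    ∀ {P₂ Qs' Q' F₂ F₂s : Module.End ℝ ((κ × S) × ι → ℝ)},
      Q' = Q + F₂ → Qs' = Qs + F₂s → P₂ = pTwo Qs Q F₂ F₂s a →
      HasMajorant (g := toB6 g Rr H) (fun q : (κ × S) × ι => blk q.1.2) F₂ (fun a a' => cFb * α₁ * Real.exp (-(δ₀ * g.dist a a'))) →
      HasMajorant (g := toB6 g Rr H) (fun q : (κ × S) × ι => blk q.1.2) F₂s (fun a a' => cFb * α₁ * Real.exp (-(δ₀ * g.dist a a'))) →
    ∃ (Tinv : Module.End ℝ (g.Site → ℝ)) (GExt : Module.End ℝ ((κ × S) × ι → ℝ)),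
      -- (ii) `C⁻¹(U′U)` = THE two-sided inverse of `Q′(U′U)G′²(U′U)Q′*(U′U)` (FILE 28, re-exported)
      Tinv * (Qc' ∘ₗ ((gPrimeExtEnd Gp (conj b (vPrimeConc T U g.eta A blk kQ kF sQ sF cfun) * Gp)) * (gPrimeExtEnd Gp (conj b (vPrimeConc T U g.eta A blk kQ kF sQ sF cfun) * Gp))) ∘ₗ Qcs') = 1 ∧
      (Qc' ∘ₗ ((gPrimeExtEnd Gp (conj b (vPrimeConc T U g.eta A blk kQ kF sQ sF cfun) * Gp)) * (gPrimeExtEnd Gp (conj b (vPrimeConc T U g.eta A blk kQ kF sQ sF cfun) * Gp))) ∘ₗ Qcs') * Tinv = 1 ∧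
      -- (iii) `G(U′U)` = THE two-sided inverse of the concrete `Δ_a(U′U)` built with this `C⁻¹(U′U)` (FILE 28, re-exported)
      deltaA (conj b (lapDDLetter T ((g.eta : ℂ)⁻¹) (prodCfg U g.eta A)))
          (conj b (dPrimeLetter T (prodCfg U g.eta A) g.eta))
          (conjHom b (gradLin T ((g.eta : ℂ)⁻¹) (prodCfg U g.eta A)) ∘ₗ (1 - ((Gp ∘ₗ Qcs ∘ₗ Linv ∘ₗ Qc ∘ₗ Gp) + (B9Eq360Vprime.pPrime Gp (gPrimeExtEnd Gp (conj b (vPrimeConc T U g.eta A blk kQ kF sQ sF cfun) * Gp)) (Qcs ∘ₗ secRes rep) (Qcs' ∘ₗ secRes rep) (secConj rep Linv) (secConj rep Tinv) (secExt rep ∘ₗ Qc) (secExt rep ∘ₗ Qc'))))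
            ∘ₗ conjHom b (divLin T ((g.eta : ℂ)⁻¹) (prodCfg U g.eta A))) Qs' a Q' * GExt = 1 ∧
      GExt *
      deltaA (conj b (lapDDLetter T ((g.eta : ℂ)⁻¹) (prodCfg U g.eta A)))
          (conj b (dPrimeLetter T (prodCfg U g.eta A) g.eta))
          (conjHom b (gradLin T ((g.eta : ℂ)⁻¹) (prodCfg U g.eta A)) ∘ₗ (1 - ((Gp ∘ₗ Qcs ∘ₗ Linv ∘ₗ Qc ∘ₗ Gp) + (B9Eq360Vprime.pPrime Gp (gPrimeExtEnd Gp (conj b (vPrimeConc T U g.eta A blk kQ kF sQ sF cfun) * Gp)) (Qcs ∘ₗ secRes rep) (Qcs' ∘ₗ secRes rep) (secConj rep Linv) (secConj rep Tinv) (secExt rep ∘ₗ Qc) (secExt rep ∘ₗ Qc'))))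
            ∘ₗ conjHom b (divLin T ((g.eta : ℂ)⁻¹) (prodCfg U g.eta A))) Qs' a Q' = 1 ∧
      -- (vii) NEW: the `L²` members (3.46)₁,₂,₃,₅ of Theorem 3.3 for THIS `G(U′U)`
      (∀ (y y' : g.Site) (hf μ : (κ × S) × ι → ℝ) (Hh : ℝ), 0 ≤ Hh → (∀ x, |hf x| ≤ Hh) → (∀ x, blk x.1.2 ≠ y → hf x = 0) →
        (∀ x, blk x.1.2 ≠ y' → μ x = 0) →
        Real.sqrt (∑ x, (hf x * GExt μ x) ^ 2) ≤ B * Hh * g.len y ^ 2 * Real.exp (-(1 / 20 * δ₀ * g.dist y y')) * Real.sqrt (∑ x, μ x ^ 2) ∧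
        (∀ k : κ ⊕ κ, Real.sqrt (∑ x, (hf x * ((conj b (diffLetter (bT T) (bU U) ((g.eta : ℂ)⁻¹) k)) * GExt) μ x) ^ 2) ≤ B * Hh * g.len y * Real.exp (-(1 / 20 * δ₀ * g.dist y y')) * Real.sqrt (∑ x, μ x ^ 2)) ∧
        (∀ l : κ ⊕ κ, Real.sqrt (∑ x, (hf x * (GExt * (conj b (diffLetter (bT T) (bU U) ((g.eta : ℂ)⁻¹) l))) μ x) ^ 2) ≤ B * Hh * g.len y * Real.exp (-(1 / 20 * δ₀ * g.dist y y')) * Real.sqrt (∑ x, μ x ^ 2)) ∧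
        (∀ k l : κ ⊕ κ, Real.sqrt (∑ x, (hf x * ((conj b (diffLetter (bT T) (bU U) ((g.eta : ℂ)⁻¹) k)) * GExt * (conj b (diffLetter (bT T) (bU U) ((g.eta : ℂ)⁻¹) l))) μ x) ^ 2) ≤ B * Hh * Real.exp (-(1 / 20 * δ₀ * g.dist y y')) * Real.sqrt (∑ x, μ x ^ 2))) := by
  classical
  obtain ⟨y₀⟩ := ‹Nonempty g.Site›
  obtain ⟨a₁, ha₁, B', hB', H28⟩ := thm34_all_final (Rr := Rr) (H := H) b T U blk d δ₀ B₀ κQ BG B₁ cF Cq a₀ C₀ d₀ M₂ κQb cFb abar kQ sQ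
    cfun w hB₀ hκQ hBG hB₁ hcF hCq ha₀ hC₀ hM₂ hδ₀ hκQb hcFb habar hdnn htri hrefl hsym hlen hlenη hη hL h261 hST hrepr hT hU1 h35 hd₀B hd₀F
    hd₀FB hd₀st hd₀loc hd₀0 hw hcard hkQ hsQ hcfun h342_1 h342_2 h342_3 hΔpGp hGpΔp rep hrep hQc hQcs hLinv h348 hQb hQsb ha324 hΔG hGΔ hG hDG
    hGD hv hc hGk hDGk hGDk hDGDk
  obtain ⟨Λ, hΛ1, hTv⟩ := hSTv (1 / 20) (by norm_num)
  have hcv : 0 ≤ cv := by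
    have h4 : 0 ≤ c * ((Finset.univ.filter (fun q : (κ × S) × ι => blk q.1.2 = y₀)).card : ℝ) := by positivity
    have h0 : 0 * v y₀ ≤ cv * v y₀ := by rw [zero_mul]; exact h4.trans (hvol y₀)
    exact le_of_mul_le_mul_right h0 (hv y₀)
  refine ⟨a₁, ha₁, cv * Λ * B', mul_nonneg (mul_nonneg hcv (zero_le_one.trans hΛ1)) hB', ?_⟩
  intro α₁ hα₁0 hα₁1 A kF sF hkF hsF h337B h337F h337B' h337Bτ h337FB hA hAτB hAτF hAFB hAst hAloc hdAst Qc' Fc Qcs' Fcs h357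
    h357s hFc hFcs P₂ Qs' Q' F₂ F₂s h380 h380s hP₂def hF₂ hF₂s
  obtain ⟨-, -, -, -, Tinv, GExt, e1, e2, -, -, -, -, -, -, -, -, -, e3, e4, -, -, K1, K2, K3, K4⟩ := H28 α₁ hα₁0 hα₁1 A kF sF hkF
    hsF h337B h337F h337B' h337Bτ h337FB hA hAτB hAτF hAFB hAst hAloc hdAst h357 h357s hFc hFcs h380 h380s hP₂def hF₂ hF₂s
  have hρ' : 1 / 20 * δ₀ + 1 / 20 * δ₀ ≤ 1 / 10 * δ₀ := by linarith only [hδ₀]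
  have hw2 : ∀ a : g.Site, 0 ≤ g.len a ^ 2 := fun a => sq_nonneg _
  have hw1 : ∀ a : g.Site, 0 ≤ g.len a := fun a => (hlen a).le
  have hw0 : ∀ _a : g.Site, (0 : ℝ) ≤ 1 := fun _ => zero_le_one
  refine ⟨Tinv, GExt, e1, e2, e3, e4, ?_⟩
  intro y y' hf μ Hh hHh hh hh0 hμ0
  refine ⟨?_, ?_, ?_, ?_⟩
  · simpa only using l2_block_of_kernelBound_transfer (R := Rr) (H := H) (fun q : (κ × S) × ι => blk q.1.2) hv hc hvol hB' hρ' hdnn hTv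
      (w := fun a => g.len a ^ 2) hw2 K1 y y' hf μ Hh hHh hh hh0 hμ0
  · intro k
    simpa only using l2_block_of_kernelBound_transfer (R := Rr) (H := H) (fun q : (κ × S) × ι => blk q.1.2) hv hc hvol hB' hρ' hdnn hTv
      (w := fun a => g.len a) hw1 (K2 k) y y' hf μ Hh hHh hh hh0 hμ0
  · intro l
    simpa only using l2_block_of_kernelBound_transfer (R := Rr) (H := H) (fun q : (κ × S) × ι => blk q.1.2) hv hc hvol hB' hρ' hdnn hTv
      (w := fun a => g.len a) hw1 (K3 l) y y' hf μ Hh hHh hh hh0 hμ0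
  · intro k l
    have K4' := hasKernelBound_mono (g := toB6 g Rr H) (fun q : (κ × S) × ι => blk q.1.2) hv (K4 k l)
      (K' := fun a a' => B' * (1 : ℝ) * Real.exp (-(1 / 10 * δ₀ * g.dist a a'))) fun a a' => le_of_eq (by ring)
    simpa only [mul_one] using l2_block_of_kernelBound_transfer (R := Rr) (H := H) (fun q : (κ × S) × ι => blk q.1.2) hv hc hvol hB' hρ' hdnn hTv
      (w := fun _ => (1 : ℝ)) hw0 K4' y y' hf μ Hh hHh hh hh0 hμ0

end FinalG

end Literature.MathematicalPhysics.QuantumFieldTheory.Balaban1983to89.B9Ineq346L2Final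

end
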